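import Summits.BirchSwinnertonDyer.BirchSwinnertonDyer.Theorems.AdditiveWildRankOneNonTowerOfConjA
import HarnessLib

/-!
# Rank ONE at an additive prime, PER-DATUM certificate kernels: `BSD_p(E)` from the ♭-IMC equality at ONE Heegner field `K`
# whose rank-zero twist `E^{(d_K)}` has `p`-UNIT analytic Ш (a numeric certificate) — the twist's LOWER half becomes trivial, its
# UPPER half is Kato A161″ (tower rows) or Coates–Sujatha (A) at that ONE twist (non-tower rows)

Prover seat `bsd-potss-kmc`, gen 21 (cell `bsd-potss`; K9 19200 `WildRankOne` / KT 19984 `TameRankOne`, row B8 O7-ss), 2026-08-27.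
HONEST FRAMING: CONDITIONAL on every displayed hypothesis; 0 definitions, 0 named facts minted, 0 `sorry`; closes nothing; BSD_p for
no curve. Companion census (kit job, evidence on 19200/19984): for each r_an = 1 additive pot-ss X4 row, the odd Heegner
discriminants `d < −4`, `|d| ≤ 150`, and `ord_p #Ш_an(E^{(d)})` of the first rank-zero twists.

Why. The class-wide kernels of gen 20/21 (`bsdp_potSS_…_of_twistLower_…`, `bsdp_wildRankOne_irreducible_…`) consume the routes' r = 0
LOWER half L₀ (19195 / 19981 — RESEARCH, Kato's IMC lower half at an additive prime) at the Heegner twists, because their proofs CHOOSE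
the Heegner field (Friedberg–Hoffstein) and must serve whatever twist comes out. Per row one can instead CHOOSE `K` so that
`ord_p #Ш_an(E^{(d_K)}) ≤ 0`: then `MissingLowerBoundAt (E^{(d_K)}) p` is TRIVIAL (§1), and `BSD_p(E)` needs the ♭-IMC equality at
that ONE datum only (both index sockets at slack `v_p(c)` by gen 20's `indexLowerBoundLeAt_of_flatInclLe_of_control` /
`indexUpperBoundLeAt_of_flatInclGe_of_control`, then kmc g17's per-datum terminal step
`SchneiderFree.Exact.bsdp_of_exactIndexManin_of_partner_halves`). This is the rank-one analogue of K1's «twist-unit lever»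
(`SchneiderFree.Upper.missingUpperBoundAt_of_jointUpper_of_twistUnit`).

* §1 `missingLowerBoundAt_of_shaAn_padicVal_nonpos` — `ord_p #Ш_an ≤ 0 ⟹ MissingLowerBoundAt` (bookkeeping).
* §2 **`bsdp_rankOne_at_datum_of_flatIMCEq_of_control_of_twistUnit_of_twistUpper`** — generic odd additive `p`, ONE datum
  `(N, K, Dt, H, ι, P)` with `d_K` odd `< −4`, a globally minimal model `Wd` of `E^{(d_K)}` with `L(E^{(d_K)},1) ≠ 0` and
  `ord_p #Ш_an(Wd) ≤ 0`: `BSD_p(W)` ⟸ ♭-IMC equality AT THIS DATUM ∧ exact control at this datum ∧ `MissingUpperBoundAt Wd p` ∧ Hsieh ∧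
  LZZ ∧ ToricPublishedInputs.
* §3 **`bsdp_potSS_towerSurj_at_unitTwistDatum_of_flatIMCEq_of_katoTam_of_facts`** — pot-ss rows (`ClassO5 ∨ ClassO6`), tower onto:
  control from the seven facts, the twist's UPPER half from A161″ ⟹ `BSD_p(W)` ⟸ ♭-IMC equality at ONE unit-twist datum + print.
  NO L₀, NO (A), NO class-wide quantifier: ONE research statement at ONE Heegner field + two numeric certificates.
* §4 **`bsdp_potSS_at_unitTwistDatum_of_flatIMCEq_of_fineSelmerDual_fg_of_facts`** — any irreducible pot-ss row (tower or not):
  the twist's UPPER half from Coates–Sujatha (A) AT THE ONE TWIST `Wd` through Kato's fine reading (gen 21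
  `missingUpperBoundAt_twist_of_irreducible_of_fineSelmerDual_fg`); (A) at a single explicit curve is what the cell's Deo–Ray–Sujatha
  / fine-anchor certificates decide per row.
* §5 `bsdp_wildRankOne_towerSurj_of_flatIMCEq_of_unitTwistCertificates_of_katoTam_of_facts` — K9 binders (`r_an = 1`, `ClassO6 W 3`,
  `TowerSurjThree W`, row predicate `R`): class form with a per-row certificate hypothesis `hCert` (∃ unit-twist datum).

References: [GrossZagier1986] I.(6.3), Thm. I.7.3; [JetchevSkinnerWan2017] §7.4.1, Thm. 3.3.1; [Hsieh2014] Thm A; [LiuZhangZhang2018]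
Thm 1.5.1/1.5.3; [Kato2004Asterisque] Thm. 14.5 (3), Prop. 14.16 (2); [CoatesSujatha2005] §3; [Serre1967GroupesPDivisibles] §5 Prop. 8;
[Miller2011LMS] Def. 1.1.
-/

noncomputable section

open scoped Classical

set_option linter.dupNamespace false
set_option autoImplicit false

namespace Summit.BirchSwinnertonDyer.BirchSwinnertonDyer.Theorems.UniversalToricDescentWaldspurgerFlat

open WeierstrassCurve NumberField IsDedekindDomain Field PowerSeries
  Literature.NumberTheory.EllipticCurves
  Literature.NumberTheory.EllipticCurves.ModularForms
  Literature.NumberTheory.EllipticCurves.Rank1Residual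
  Literature.NumberTheory.EllipticCurves.Rank1Residual.Typed
  Literature.NumberTheory.EllipticCurves.KrizLi2019
  Literature.NumberTheory.GaloisRepresentations
  Literature.NumberTheory.GaloisCohomology
  Summit.BirchSwinnertonDyer.Rank1Residual
  Summit.BirchSwinnertonDyer.Rank1Residual.Additive
  Summit.BirchSwinnertonDyer.Rank1Residual.X11b
  Summit.BirchSwinnertonDyer.Rank1Residual.X11b.AcSelmer
  Summit.BirchSwinnertonDyer.Rank1Residual.X11b.Halves
  Summit.BirchSwinnertonDyer.Rank1Residual.X11b.CongruenceLimit
  Summit.BirchSwinnertonDyer.BirchSwinnertonDyer.Theses.UniversalToricDescent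
  Summit.BirchSwinnertonDyer.BirchSwinnertonDyer.Theorems.AdditivePotSupersingularControl

/-! ## §1 A `p`-unit analytic Ш makes the LOWER half trivial -/

/-- **`ord_p #Ш_an(Wd) ≤ 0 ⟹ MissingLowerBoundAt Wd p`** (`0 ≤ ord_p #Ш` trivially). Bookkeeping on Miller's currency; the
hypothesis is a per-row NUMERIC certificate (BSD numerics of an explicit rank-zero curve). [cite: Miller2011LMS, Def. 1.1 (arXiv:1010.2431 p. 3)] -/
theorem missingLowerBoundAt_of_shaAn_padicVal_nonpos (Wd : WeierstrassCurve ℚ) (p : ℕ)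
    (hunit : ∃ qd : ℚ, shaAn Wd = (qd : ℂ) ∧ padicValRat p qd ≤ 0) : MissingLowerBoundAt Wd p := by
  obtain ⟨qd, hqd, hle⟩ := hunit
  exact ⟨qd, hqd, le_trans hle (by exact_mod_cast Nat.zero_le _)⟩

/-! ## §2 The per-datum kernel: ♭-IMC equality at ONE datum + control + unit twist + the twist's UPPER half -/

section Datum

variable {p : ℕ} [Fact p.Prime] {W : WeierstrassCurve ℚ} [W.IsElliptic] [W.IsGloballyMinimal]
  {N : ℕ} [NeZero N] {K : Type} [Field K] [NumberField K]

/-- **`BSD_p` in analytic rank one at an odd additive prime from the ♭-IMC equality at ONE Heegner datum whose twist has `p`-unit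
analytic Ш.** Data: `W` globally minimal, additive at the odd `p`, `r_an = 1`; `K` imaginary quadratic Heegner for `N = N(E)` with
`d_K` odd `< −4`; `(Dt, H, ι, P)` a Heegner datum of level `N` (`P` the Heegner point); `Wd` a globally minimal model of `E^{(d_K)}`
with `L(E^{(d_K)},1) ≠ 0` and `ord_p #Ш_an(Wd) ≤ 0`. Hypotheses: `hEq` the ♭-(∅,0)-IMC EQUALITY at every anticyclotomic frame OF
THIS `K` (RESEARCH), `hCtl` exact control at every degree-one frame of this datum, `hUp` the twist's r = 0 UPPER half, and print
(Hsieh, LZZ, ToricPublishedInputs: GZ, Kolyvagin, GZK, modularity, GZ I.7.3). Proof: `P` non-torsion (Gross–Zagier), both index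
sockets at slack `v_p(c)` (gen 20), twist LOWER half trivial (§1), kmc g17's `bsdp_of_exactIndexManin_of_partner_halves`. CONDITIONAL.
[cite: GrossZagier1986, I.(6.3) and Thm. I.7.3] [cite: JetchevSkinnerWan2017, §7.4.1 (arXiv:1512.06894 p. 30)]
[cite: Hsieh2014, Thm. A p. 712 (Doc. Math. 19)] [cite: LiuZhangZhang2018, Thm 1.5.1 and Thm 1.5.3 (Duke Math. J. 167 pp. 748–749)] -/
theorem bsdp_rankOne_at_datum_of_flatIMCEq_of_control_of_twistUnit_of_twistUpper (hp2 : p ≠ 2)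
    (hA : Hsieh2014.thmA_exists_isHsiehLFunction_unrPeriod_anyLevel)
    (hL : LiuZhangZhang2018.thm151_thm153_modularCurve_heegnerVector_additive)
    (hF : ToricPublishedInputs)
    (haddv : Addv W p) (hr : W.analyticRank = 1)
    (Dt : ModularParametrizationData W N) (H : HeegnerDatum N (NumberField.discr K)) (ι : K →+* ℂ)
    (P : (W.baseChange K).toAffine.Point) (Wd : WeierstrassCurve ℚ) [Wd.IsElliptic] [Wd.IsGloballyMinimal]
    (hN : W.conductorNorm ℤ = N) (hK : IsImaginaryQuadratic K) (hHN : SatisfiesHeegnerHypothesis N K)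
    (hodd : Odd (NumberField.discr K)) (hd4 : NumberField.discr K < -4)
    (hLt : (W.quadraticTwist (NumberField.discr K : ℚ)).entireLFunction 1 ≠ 0)
    (hP : WeierstrassCurve.Affine.Point.map ι.toRatAlgHom P = heegnerPointComplex Dt H)
    (hC : ∃ C : VariableChange ℚ, C • W.quadraticTwist (NumberField.discr K : ℚ) = Wd)
    (hEq : ∀ (κ : ZpExtension K p), κ.IsAnticyclotomic → ∀ (γ : Field.absoluteGaloisGroup K) [Fact (κ.IsTopGenerator γ)]
        (𝔭 : HeightOneSpectrum (𝓞 K)), ((p : ℕ) : 𝓞 K) ∈ 𝔭.asIdeal → 𝔭.asIdeal.ramificationIdx (𝓞 ℚ) = 1 →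
        𝔭.asIdeal.inertiaDeg (𝓞 ℚ) = 1 → ∀ (𝔭' : HeightOneSpectrum (𝓞 K)), ((p : ℕ) : 𝓞 K) ∈ 𝔭'.asIdeal → 𝔭' ≠ 𝔭 →
        ∀ (ι' : PadicAlgCl p ≃+* ℂ), SchneiderFree.BranchInducesPrime p ι' 𝔭 →
        ∀ (ΩK : ℂ) (Ωp : ℂ_[p]) (Q : PowerSeries (PadicComplexInt p)), ΩK ≠ 0 → Ωp ≠ 0 →
          R1.IsBDPLFunctionInt p ι' 𝔭 κ γ Dt.f ΩK Ωp Q →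
          (XAc.charIdeal (W.baseChange K) p κ 𝔭' ∅ γ).map (PowerSeries.map (R1.toCpInt p)) = Ideal.span {Q})
    (hCtl : ∀ (κ : ZpExtension K p), κ.IsAnticyclotomic → ∀ (γ : Field.absoluteGaloisGroup K) [Fact (κ.IsTopGenerator γ)]
        (𝔭 : HeightOneSpectrum (𝓞 K)) (h𝔭 : ((p : ℕ) : 𝓞 K) ∈ 𝔭.asIdeal) (he : 𝔭.asIdeal.ramificationIdx (𝓞 ℚ) = 1)
        (hf : 𝔭.asIdeal.inertiaDeg (𝓞 ℚ) = 1), SchneiderFree.AdditiveControlOnTreeAt p κ 𝔭 γ (embAt K p 𝔭 h𝔭 he hf) P)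
    (hunit : ∃ qd : ℚ, shaAn Wd = (qd : ℂ) ∧ padicValRat p qd ≤ 0) (hUp : MissingUpperBoundAt Wd p) : BSDp W p := by
  have hp : p.Prime := Fact.out
  obtain ⟨hGZ, hKo, hGZK, hmod, hmodP, -, hGZ73, hFH, hpar, hHP⟩ := hF
  have hwK : ¬ p ∣ Units.torsionOrder K := by
    rw [Literature.NumberTheory.QuadraticFields.Quadratic.torsionOrder_eq_two_of_discr_lt_neg_four hK.1 hd4]
    intro h
    exact hp2 ((Nat.prime_dvd_prime_iff_eq hp Nat.prime_two).mp h)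
  have hpN : p ∣ N := by
    rw [← hN]; exact (W.dvd_conductorNorm_iff_not_hasGoodReductionAtPrime p).mpr (not_good_of_addv W p haddv)
  -- the Heegner point is non-torsion (Gross–Zagier: `L'(E/K,1) = L'(E,1)·L(E^{d},1) ≠ 0`)
  have hL0 : W.entireLFunction 1 = 0 := entireLFunction_one_eq_zero_of_analyticRank_eq_one hr
  obtain ⟨-, hderiv⟩ := leadingLCoeff_eq_deriv_of_analyticRank_eq_one hr
  have hLK : LDerivEK W K ≠ 0 := by
    rw [lDerivEK_eq_deriv_mul W K hmod hL0]; exact mul_ne_zero hderiv hLt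
  have hnt : ¬ IsOfFinAddOrder P :=
    (lDerivEK_ne_zero_iff_not_isOfFinAddOrder W N K (hGZ N W K) hK hHN ⟨Dt, H, ι, hP⟩).mp hLK
  -- both index sockets at slack `v_p(c)` from the equality + control
  have hlo : SchneiderFree.IndexLowerBoundLeAt W p K P (padicValNat p Dt.c.natAbs) :=
    indexLowerBoundLeAt_of_flatInclLe_of_control hp2 hA hL Dt H ι P haddv hN hK hHN hd4 hP hnt (hKo N W K)
      (fun κ hκ γ _ 𝔭 h𝔭 he hf 𝔭' h𝔭' hne ι' hind ΩK Ωp Q hΩK hΩp hBDP ↦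
        (hEq κ hκ γ 𝔭 h𝔭 he hf 𝔭' h𝔭' hne ι' hind ΩK Ωp Q hΩK hΩp hBDP).le) hCtl
  have hup : SchneiderFree.Upper.IndexUpperBoundLeAt W p K P (padicValNat p Dt.c.natAbs) :=
    indexUpperBoundLeAt_of_flatInclGe_of_control hp2 hA hL Dt H ι P haddv hN hK hHN hd4 hP hnt (hKo N W K)
      (fun κ hκ γ _ 𝔭 h𝔭 he hf 𝔭' h𝔭' hne ι' hind ΩK Ωp Q hΩK hΩp hBDP ↦
        (hEq κ hκ γ 𝔭 h𝔭 he hf 𝔭' h𝔭' hne ι' hind ΩK Ωp Q hΩK hΩp hBDP).ge) hCtl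
  exact SchneiderFree.Exact.bsdp_of_exactIndexManin_of_partner_halves hGZ hKo hGZK hmod hGZ73 W p N K Dt H ι P Wd hr hN hpN hK
    hodd hwK hHN hLt hP hC hp2 hlo hup (missingLowerBoundAt_of_shaAn_padicVal_nonpos Wd p hunit) hUp

end Datum

section PotSS

variable (p : ℕ) [Fact p.Prime]

/-! ## §3 Potentially supersingular rows, tower onto: ONE research statement at ONE unit-twist datum + print -/

/-- **`BSD_p` in analytic rank one at an odd additive potentially SUPERSINGULAR prime, TOWER onto, from the ♭-IMC equality at ONE
unit-twist Heegner datum (modulo print).** Row: `ClassO5 W p ∨ ClassO6 W p`, `ρ_{E,p^n}` onto for all `n`, `r_an = 1`. Datum as in §2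
with the two certificates `L(E^{(d_K)},1) ≠ 0`, `ord_p #Ш_an(Wd) ≤ 0`. Hypotheses: `hEq` (♭-IMC equality at the frames of THIS `K` —
the ONLY research input) + A161″ + the seven cohomological facts + Hsieh + LZZ + ToricPublishedInputs. Control:
`additiveControl_heegner_potSS_of_facts_of_serre1967`; the twist's UPPER half: `missingUpperBoundAt_twist_of_towerSurj_of_katoTam`;
its LOWER half: trivial (§1). No L₀, no (A). CONDITIONAL; closes nothing; BSD_p for no curve.
[cite: JetchevSkinnerWan2017, §7.4.1 and Thm. 3.3.1 (arXiv:1512.06894)] [cite: Kato2004Asterisque, Thm. 14.5 (3), Prop. 14.16 (2)]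
[cite: Serre1967GroupesPDivisibles, §5 Prop. 8] [cite: GrossZagier1986, I.(6.3) and Thm. I.7.3] -/
theorem bsdp_potSS_towerSurj_at_unitTwistDatum_of_flatIMCEq_of_katoTam_of_facts (hp2 : p ≠ 2)
    (hA : Hsieh2014.thmA_exists_isHsiehLFunction_unrPeriod_anyLevel)
    (hL : LiuZhangZhang2018.thm151_thm153_modularCurve_heegnerVector_additive)
    (hF : ToricPublishedInputs)
    (hKatoT : Kato2004.rankZero_padicValNat_sha_add_padicValNat_tamagawa_le_of_additive_potGood_of_imageContainsSL2)
    (hPT : ∀ (K : Type) [Field K] [NumberField K], poitouTate_selmerStructure_duality K)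
    (hPT2 : ∀ (K : Type) [Field K] [NumberField K], poitouTate_sha_tateDual K)
    (hEP : ∀ (K : Type) [Field K] [NumberField K] (v : HeightOneSpectrum (𝓞 K)),
      localEulerPoincareCharacteristic (v.adicCompletion K))
    (hcd : fieldCdLE_two_of_numberField)
    (hBr : ∀ (K : Type) [Field K] [NumberField K] (p : ℕ) [Fact p.Prime],
      ZpExtension.decomp_not_le_kerSubgroup_of_isAnticyclotomic K p)
    (hBr2 : ∀ (K : Type) [Field K] [NumberField K] (p : ℕ) [Fact p.Prime],
      ZpExtension.decomp_not_le_kerSubgroup_above_of_isAnticyclotomic K p)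
    (hS : Serre1967.noStableDivisibleLine_of_potentiallySupersingular)
    (W : WeierstrassCurve ℚ) [W.IsElliptic] [W.IsGloballyMinimal] (hcls : ClassO5 W p ∨ ClassO6 W p)
    (hsurj : ∀ n : ℕ, W.HasSurjectiveModNGaloisRep (p ^ n : ℕ)) (hr : W.analyticRank = 1)
    {N : ℕ} [NeZero N] {K : Type} [Field K] [NumberField K]
    (Dt : ModularParametrizationData W N) (H : HeegnerDatum N (NumberField.discr K)) (ι : K →+* ℂ)
    (P : (W.baseChange K).toAffine.Point) (Wd : WeierstrassCurve ℚ) [Wd.IsElliptic] [Wd.IsGloballyMinimal]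
    (hN : W.conductorNorm ℤ = N) (hK : IsImaginaryQuadratic K) (hHN : SatisfiesHeegnerHypothesis N K)
    (hodd : Odd (NumberField.discr K)) (hd4 : NumberField.discr K < -4)
    (hLt : (W.quadraticTwist (NumberField.discr K : ℚ)).entireLFunction 1 ≠ 0)
    (hP : WeierstrassCurve.Affine.Point.map ι.toRatAlgHom P = heegnerPointComplex Dt H)
    (hC : ∃ C : VariableChange ℚ, C • W.quadraticTwist (NumberField.discr K : ℚ) = Wd)
    (hunit : ∃ qd : ℚ, shaAn Wd = (qd : ℂ) ∧ padicValRat p qd ≤ 0)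
    (hEq : ∀ (κ : ZpExtension K p), κ.IsAnticyclotomic → ∀ (γ : Field.absoluteGaloisGroup K) [Fact (κ.IsTopGenerator γ)]
        (𝔭 : HeightOneSpectrum (𝓞 K)), ((p : ℕ) : 𝓞 K) ∈ 𝔭.asIdeal → 𝔭.asIdeal.ramificationIdx (𝓞 ℚ) = 1 →
        𝔭.asIdeal.inertiaDeg (𝓞 ℚ) = 1 → ∀ (𝔭' : HeightOneSpectrum (𝓞 K)), ((p : ℕ) : 𝓞 K) ∈ 𝔭'.asIdeal → 𝔭' ≠ 𝔭 →
        ∀ (ι' : PadicAlgCl p ≃+* ℂ), SchneiderFree.BranchInducesPrime p ι' 𝔭 →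
        ∀ (ΩK : ℂ) (Ωp : ℂ_[p]) (Q : PowerSeries (PadicComplexInt p)), ΩK ≠ 0 → Ωp ≠ 0 →
          R1.IsBDPLFunctionInt p ι' 𝔭 κ γ Dt.f ΩK Ωp Q →
          (XAc.charIdeal (W.baseChange K) p κ 𝔭' ∅ γ).map (PowerSeries.map (R1.toCpInt p)) = Ideal.span {Q}) :
    BSDp W p := by
  have hp : p.Prime := Fact.out
  have haddv : Addv W p := hcls.elim (fun h ↦ h.2.1) (fun h ↦ h.2.1)
  have hj : 0 ≤ padicValRat p W.j := hcls.elim (fun h ↦ h.padicValRat_j_nonneg) (fun h ↦ h.padicValRat_j_nonneg)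
  have hirr : W.HasIrreducibleModPGaloisRep p := by
    have h1 := hsurj 1
    simp only [pow_one] at h1
    haveI : NeZero (p : ℚ) := ⟨by exact_mod_cast hp.ne_zero⟩
    exact hasIrreducibleModPGaloisRep_of_hasSurjectiveModNGaloisRep W p (by exact_mod_cast h1)
  have hGZK : rank_eq_analyticRank_of_analyticRank_le_one := hF.2.2.1
  have hmod : hasEntireLFunction_rat := hF.2.2.2.1
  have hGZ : ∀ (N : ℕ) [NeZero N] (W : WeierstrassCurve ℚ) (K : Type) [Field K] [NumberField K],
      Literature.NumberTheory.EllipticCurves.gross_zagier N W K := hF.1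
  have hKo : ∀ (N : ℕ) [NeZero N] (W : WeierstrassCurve ℚ) (K : Type) [Field K] [NumberField K],
      Literature.NumberTheory.EllipticCurves.kolyvagin N W K := hF.2.1
  -- non-torsion of `P` (needed by the control theorem)
  have hL0 : W.entireLFunction 1 = 0 := entireLFunction_one_eq_zero_of_analyticRank_eq_one hr
  obtain ⟨-, hderiv⟩ := leadingLCoeff_eq_deriv_of_analyticRank_eq_one hr
  have hLK : LDerivEK W K ≠ 0 := by
    rw [lDerivEK_eq_deriv_mul W K hmod hL0]; exact mul_ne_zero hderiv hLt
  have hnt : ¬ IsOfFinAddOrder P :=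
    (lDerivEK_ne_zero_iff_not_isOfFinAddOrder W N K (hGZ N W K) hK hHN ⟨Dt, H, ι, hP⟩).mp hLK
  refine bsdp_rankOne_at_datum_of_flatIMCEq_of_control_of_twistUnit_of_twistUpper hp2 hA hL hF haddv hr Dt H ι P Wd hN hK
    hHN hodd hd4 hLt hP hC hEq ?_ hunit ?_
  · intro κ hκ γ _ 𝔭 h𝔭 he hf
    exact additiveControl_heegner_potSS_of_facts_of_serre1967 hPT hPT2 hEP hcd hBr hBr2 hS p W N K Dt H ι P hcls hirr hN hK hHN
      hP hnt (hKo N W K) κ hκ γ 𝔭 h𝔭 he hf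
  · exact missingUpperBoundAt_twist_of_towerSurj_of_katoTam p hp2 hKatoT hGZK hmod W haddv hj hsurj hN K hK hHN Wd hC hLt

/-! ## §4 Potentially supersingular rows, ANY irreducible image: (A) at the ONE twist instead of A161″ -/

/-- **`BSD_p` in analytic rank one at an odd additive potentially SUPERSINGULAR prime, `ρ̄_{E,p}` irreducible (tower onto OR NOT),
from the ♭-IMC equality at ONE unit-twist Heegner datum and Coates–Sujatha (A) AT THAT ONE TWIST (modulo print).** As §3 with the
twist's UPPER half from `hAd` := the finite generation over `ℤ_p` of the dual fine Selmer group of the explicit rank-zero curve `Wd`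
(what a Deo–Ray–Sujatha / fine-anchor certificate decides per row) through Kato's fine reading `hKatoA` (gen 21
`missingUpperBoundAt_twist_of_irreducible_of_fineSelmerDual_fg`). CONDITIONAL; closes nothing; BSD_p for no curve.
[cite: JetchevSkinnerWan2017, §7.4.1 and Thm. 3.3.1 (arXiv:1512.06894)] [cite: Kato2004Asterisque, Thm. 14.5 (3), Prop. 14.16 (2)]
[cite: CoatesSujatha2005, §3 (Conjecture A)] [cite: Serre1967GroupesPDivisibles, §5 Prop. 8] -/
theorem bsdp_potSS_at_unitTwistDatum_of_flatIMCEq_of_fineSelmerDual_fg_of_facts (hp2 : p ≠ 2)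
    (hA : Hsieh2014.thmA_exists_isHsiehLFunction_unrPeriod_anyLevel)
    (hL : LiuZhangZhang2018.thm151_thm153_modularCurve_heegnerVector_additive)
    (hF : ToricPublishedInputs)
    (hKatoA :
      Kato2004.rankZero_padicValNat_sha_add_padicValNat_tamagawa_le_of_additive_potGood_of_irreducible_of_fineSelmerDual_fg)
    (hPT : ∀ (K : Type) [Field K] [NumberField K], poitouTate_selmerStructure_duality K)
    (hPT2 : ∀ (K : Type) [Field K] [NumberField K], poitouTate_sha_tateDual K)
    (hEP : ∀ (K : Type) [Field K] [NumberField K] (v : HeightOneSpectrum (𝓞 K)),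
      localEulerPoincareCharacteristic (v.adicCompletion K))
    (hcd : fieldCdLE_two_of_numberField)
    (hBr : ∀ (K : Type) [Field K] [NumberField K] (p : ℕ) [Fact p.Prime],
      ZpExtension.decomp_not_le_kerSubgroup_of_isAnticyclotomic K p)
    (hBr2 : ∀ (K : Type) [Field K] [NumberField K] (p : ℕ) [Fact p.Prime],
      ZpExtension.decomp_not_le_kerSubgroup_above_of_isAnticyclotomic K p)
    (hS : Serre1967.noStableDivisibleLine_of_potentiallySupersingular)
    (W : WeierstrassCurve ℚ) [W.IsElliptic] [W.IsGloballyMinimal] (hcls : ClassO5 W p ∨ ClassO6 W p)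
    (hirr : W.HasIrreducibleModPGaloisRep p) (hr : W.analyticRank = 1)
    {N : ℕ} [NeZero N] {K : Type} [Field K] [NumberField K]
    (Dt : ModularParametrizationData W N) (H : HeegnerDatum N (NumberField.discr K)) (ι : K →+* ℂ)
    (P : (W.baseChange K).toAffine.Point) (Wd : WeierstrassCurve ℚ) [Wd.IsElliptic] [Wd.IsGloballyMinimal]
    (hN : W.conductorNorm ℤ = N) (hK : IsImaginaryQuadratic K) (hHN : SatisfiesHeegnerHypothesis N K)
    (hodd : Odd (NumberField.discr K)) (hd4 : NumberField.discr K < -4)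
    (hLt : (W.quadraticTwist (NumberField.discr K : ℚ)).entireLFunction 1 ≠ 0)
    (hP : WeierstrassCurve.Affine.Point.map ι.toRatAlgHom P = heegnerPointComplex Dt H)
    (hC : ∃ C : VariableChange ℚ, C • W.quadraticTwist (NumberField.discr K : ℚ) = Wd)
    (hunit : ∃ qd : ℚ, shaAn Wd = (qd : ℂ) ∧ padicValRat p qd ≤ 0)
    (hAd : ∀ (κ : ZpExtension ℚ p), κ.IsCyclotomic →
      ∃ (γ : Field.absoluteGaloisGroup ℚ) (D : Wd.FineSelmerDualData κ γ),
        Module.Finite ℤ_[p] (RestrictScalars ℤ_[p] (IwasawaAlgebra p) D.X))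
    (hEq : ∀ (κ : ZpExtension K p), κ.IsAnticyclotomic → ∀ (γ : Field.absoluteGaloisGroup K) [Fact (κ.IsTopGenerator γ)]
        (𝔭 : HeightOneSpectrum (𝓞 K)), ((p : ℕ) : 𝓞 K) ∈ 𝔭.asIdeal → 𝔭.asIdeal.ramificationIdx (𝓞 ℚ) = 1 →
        𝔭.asIdeal.inertiaDeg (𝓞 ℚ) = 1 → ∀ (𝔭' : HeightOneSpectrum (𝓞 K)), ((p : ℕ) : 𝓞 K) ∈ 𝔭'.asIdeal → 𝔭' ≠ 𝔭 →
        ∀ (ι' : PadicAlgCl p ≃+* ℂ), SchneiderFree.BranchInducesPrime p ι' 𝔭 →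
        ∀ (ΩK : ℂ) (Ωp : ℂ_[p]) (Q : PowerSeries (PadicComplexInt p)), ΩK ≠ 0 → Ωp ≠ 0 →
          R1.IsBDPLFunctionInt p ι' 𝔭 κ γ Dt.f ΩK Ωp Q →
          (XAc.charIdeal (W.baseChange K) p κ 𝔭' ∅ γ).map (PowerSeries.map (R1.toCpInt p)) = Ideal.span {Q}) :
    BSDp W p := by
  have haddv : Addv W p := hcls.elim (fun h ↦ h.2.1) (fun h ↦ h.2.1)
  have hj : 0 ≤ padicValRat p W.j := hcls.elim (fun h ↦ h.padicValRat_j_nonneg) (fun h ↦ h.padicValRat_j_nonneg)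
  have hGZK : rank_eq_analyticRank_of_analyticRank_le_one := hF.2.2.1
  have hmod : hasEntireLFunction_rat := hF.2.2.2.1
  have hGZ : ∀ (N : ℕ) [NeZero N] (W : WeierstrassCurve ℚ) (K : Type) [Field K] [NumberField K],
      Literature.NumberTheory.EllipticCurves.gross_zagier N W K := hF.1
  have hKo : ∀ (N : ℕ) [NeZero N] (W : WeierstrassCurve ℚ) (K : Type) [Field K] [NumberField K],
      Literature.NumberTheory.EllipticCurves.kolyvagin N W K := hF.2.1
  have hL0 : W.entireLFunction 1 = 0 := entireLFunction_one_eq_zero_of_analyticRank_eq_one hr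
  obtain ⟨-, hderiv⟩ := leadingLCoeff_eq_deriv_of_analyticRank_eq_one hr
  have hLK : LDerivEK W K ≠ 0 := by
    rw [lDerivEK_eq_deriv_mul W K hmod hL0]; exact mul_ne_zero hderiv hLt
  have hnt : ¬ IsOfFinAddOrder P :=
    (lDerivEK_ne_zero_iff_not_isOfFinAddOrder W N K (hGZ N W K) hK hHN ⟨Dt, H, ι, hP⟩).mp hLK
  refine bsdp_rankOne_at_datum_of_flatIMCEq_of_control_of_twistUnit_of_twistUpper hp2 hA hL hF haddv hr Dt H ι P Wd hN hK
    hHN hodd hd4 hLt hP hC hEq ?_ hunit ?_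
  · intro κ hκ γ _ 𝔭 h𝔭 he hf
    exact additiveControl_heegner_potSS_of_facts_of_serre1967 hPT hPT2 hEP hcd hBr hBr2 hS p W N K Dt H ι P hcls hirr hN hK hHN
      hP hnt (hKo N W K) κ hκ γ 𝔭 h𝔭 he hf
  · exact missingUpperBoundAt_twist_of_irreducible_of_fineSelmerDual_fg p hp2 hKatoA hGZK hmod W haddv hj hirr hN K hK hHN Wd
      hC hLt hAd

end PotSS

section WildThree

variable [Fact (3 : ℕ).Prime] (R : WeierstrassCurve ℚ → Prop)

/-! ## §5 K9 binders: the tower-surjective rows of 19200 from the IMC + per-row unit-twist certificates -/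

/-- **K9's `WildRankOne` on the TOWER-SURJECTIVE rows from the ♭-IMC equality and per-row UNIT-TWIST CERTIFICATES (modulo print).**
For any row predicate `R`: on `r_an = 1`, `ClassO6 W 3`, `TowerSurjThree W`, `R W`: `BSDp W 3` ⟸ `hEq` (♭-IMC equality on the class rows'
Heegner data — RESEARCH) ∧ `hCert` (for every class row SOME odd Heegner datum `d_K < −4` with `L(E^{(d_K)},1) ≠ 0` and a globally
minimal model of `E^{(d_K)}` with `3`-unit analytic Ш — a per-row numeric certificate, census job of this seat) ∧ A161″ ∧ the seven
cohomological facts ∧ Hsieh ∧ LZZ ∧ ToricPublishedInputs. No L₀, no (A). CONDITIONAL; closes nothing; BSD₃ for no curve.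
[cite: JetchevSkinnerWan2017, §7.4.1 and Thm. 3.3.1 (arXiv:1512.06894)] [cite: Kato2004Asterisque, Thm. 14.5 (3), Prop. 14.16 (2)]
[cite: Serre1967GroupesPDivisibles, §5 Prop. 8] [cite: GrossZagier1986, I.(6.3) and Thm. I.7.3] -/
theorem bsdp_wildRankOne_towerSurj_of_flatIMCEq_of_unitTwistCertificates_of_katoTam_of_facts
    (hA : Hsieh2014.thmA_exists_isHsiehLFunction_unrPeriod_anyLevel)
    (hL : LiuZhangZhang2018.thm151_thm153_modularCurve_heegnerVector_additive)
    (hF : ToricPublishedInputs)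
    (hKatoT : Kato2004.rankZero_padicValNat_sha_add_padicValNat_tamagawa_le_of_additive_potGood_of_imageContainsSL2)
    (hPT : ∀ (K : Type) [Field K] [NumberField K], poitouTate_selmerStructure_duality K)
    (hPT2 : ∀ (K : Type) [Field K] [NumberField K], poitouTate_sha_tateDual K)
    (hEP : ∀ (K : Type) [Field K] [NumberField K] (v : HeightOneSpectrum (𝓞 K)),
      localEulerPoincareCharacteristic (v.adicCompletion K))
    (hcd : fieldCdLE_two_of_numberField)
    (hBr : ∀ (K : Type) [Field K] [NumberField K] (p : ℕ) [Fact p.Prime],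
      ZpExtension.decomp_not_le_kerSubgroup_of_isAnticyclotomic K p)
    (hBr2 : ∀ (K : Type) [Field K] [NumberField K] (p : ℕ) [Fact p.Prime],
      ZpExtension.decomp_not_le_kerSubgroup_above_of_isAnticyclotomic K p)
    (hS : Serre1967.noStableDivisibleLine_of_potentiallySupersingular)
    (hEq : ∀ (W : WeierstrassCurve ℚ) [W.IsElliptic] [W.IsGloballyMinimal] (N : ℕ) [NeZero N] (K : Type) [Field K]
      [NumberField K] (Dt : ModularParametrizationData W N),
      R W → ClassO6 W 3 → AdditiveThree.TowerSurjThree W → W.analyticRank = 1 →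
      W.conductorNorm ℤ = N → IsImaginaryQuadratic K → SatisfiesHeegnerHypothesis N K →
      ∀ (κ : ZpExtension K 3), κ.IsAnticyclotomic → ∀ (γ : Field.absoluteGaloisGroup K) [Fact (κ.IsTopGenerator γ)]
        (𝔭 : HeightOneSpectrum (𝓞 K)), ((3 : ℕ) : 𝓞 K) ∈ 𝔭.asIdeal → 𝔭.asIdeal.ramificationIdx (𝓞 ℚ) = 1 →
        𝔭.asIdeal.inertiaDeg (𝓞 ℚ) = 1 → ∀ (𝔭' : HeightOneSpectrum (𝓞 K)), ((3 : ℕ) : 𝓞 K) ∈ 𝔭'.asIdeal → 𝔭' ≠ 𝔭 →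
        ∀ (ι' : PadicAlgCl 3 ≃+* ℂ), SchneiderFree.BranchInducesPrime 3 ι' 𝔭 →
        ∀ (ΩK : ℂ) (Ωp : ℂ_[3]) (Q : PowerSeries (PadicComplexInt 3)), ΩK ≠ 0 → Ωp ≠ 0 →
          R1.IsBDPLFunctionInt 3 ι' 𝔭 κ γ Dt.f ΩK Ωp Q →
          (XAc.charIdeal (W.baseChange K) 3 κ 𝔭' ∅ γ).map (PowerSeries.map (R1.toCpInt 3)) = Ideal.span {Q})
    (hCert : ∀ (W : WeierstrassCurve ℚ) [W.IsElliptic] [W.IsGloballyMinimal],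
      R W → ClassO6 W 3 → AdditiveThree.TowerSurjThree W → W.analyticRank = 1 →
      ∃ (N : ℕ) (_ : NeZero N) (K : Type) (_ : Field K) (_ : NumberField K) (Dt : ModularParametrizationData W N)
        (H : HeegnerDatum N (NumberField.discr K)) (ι : K →+* ℂ) (P : (W.baseChange K).toAffine.Point)
        (Wd : WeierstrassCurve ℚ) (_ : Wd.IsElliptic) (_ : Wd.IsGloballyMinimal),
        W.conductorNorm ℤ = N ∧ IsImaginaryQuadratic K ∧ SatisfiesHeegnerHypothesis N K ∧ Odd (NumberField.discr K) ∧
        NumberField.discr K < -4 ∧ (W.quadraticTwist (NumberField.discr K : ℚ)).entireLFunction 1 ≠ 0 ∧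
        WeierstrassCurve.Affine.Point.map ι.toRatAlgHom P = heegnerPointComplex Dt H ∧
        (∃ C : VariableChange ℚ, C • W.quadraticTwist (NumberField.discr K : ℚ) = Wd) ∧
        (∃ qd : ℚ, shaAn Wd = (qd : ℂ) ∧ padicValRat 3 qd ≤ 0)) :
    ∀ (W : WeierstrassCurve ℚ) [W.IsElliptic] [W.IsGloballyMinimal], W.analyticRank = 1 → ClassO6 W 3 →
      AdditiveThree.TowerSurjThree W → R W → BSDp W 3 := by
  intro W _ _ hr hO6 hT hR
  have hsurj := forall_hasSurjectiveModNGaloisRep_pow_three_of_towerSurjThree W hT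
  obtain ⟨N, _, K, _, _, Dt, H, ι, P, Wd, _, _, hN, hK, hHN, hodd, hd4, hLt, hP, hC, hunit⟩ := hCert W hR hO6 hT hr
  exact bsdp_potSS_towerSurj_at_unitTwistDatum_of_flatIMCEq_of_katoTam_of_facts 3 (by decide) hA hL hF hKatoT hPT hPT2 hEP hcd hBr
    hBr2 hS W (Or.inr hO6) hsurj hr Dt H ι P Wd hN hK hHN hodd hd4 hLt hP hC hunit
    (fun κ hκ γ _ 𝔭 h𝔭 he hf 𝔭' h𝔭' hne ι' hind ΩK Ωp Q hΩK hΩp hBDP ↦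
      hEq W N K Dt hR hO6 hT hr hN hK hHN κ hκ γ 𝔭 h𝔭 he hf 𝔭' h𝔭' hne ι' hind ΩK Ωp Q hΩK hΩp hBDP)

end WildThree

end Summit.BirchSwinnertonDyer.BirchSwinnertonDyer.Theorems.UniversalToricDescentWaldspurgerFlat

end
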